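import Summits.PneNP.PneNP.Theses.SymmetryBudget
import Summits.PneNP.PneNP.Theses.Circuit
import Literature.Computability.Complexity.SymmetricCircuit

/-!
# See-saw sketch (ideator 3, generation 2, crux-ideate round 1) — crux `SymmetryBudget.WindowHam`
(stmt-PneNP-2143), route-PneNP-SymmetryBudget.

Obstruction-side statements only (sorried where they rest on the collapse F10 resp. on the
support theorem + counting width); they type-check the claim of `SeeSaw-ideator3g2-r1.md`:
for EVERY budget function `g`, one of the two cruxes of the route shape
`WindowHamAt g ∧ HamCompilesAt g → PneNP` is settled outright and the other one carries at least
the summit (`PneNP`) resp. `¬ CircuitNeg` (NP ⊄ P/poly). Re-keying the budget cannot rescue the route.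

Self-contained over the landed vocabulary (`HasSymCircuit`, `pointStabiliserBudget`): the §0 block
restates `HamFn`, `WindowHamAt`, `HamHardGeneral` and their three one-line lemmas VERBATIM from
`Cruxes/WindowHam/Disproof.lean` (F1/F3), so that this file does not import the disprover's work file
(whose farm build lagged its source at filing time).
-/

namespace Summit.PneNP.PneNP.Cruxes.WindowHam.SeeSaw

open Literature.Computability.Complexity Filter
open Summit.PneNP.PneNP.Theses.SymmetryBudget (WindowHam PolylogHam HamCompiles)
open Summit.PneNP.PneNP.Theses.Circuit (CircuitNeg)
open scoped Classical

set_option linter.dupNamespace false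

/-! ## §0 Vocabulary (verbatim from Disproof.lean F1/F3) -/

/-- Hamiltonicity of the decoded simple graph, as a Boolean function (route convention). -/
noncomputable def HamFn (m : ℕ) : (Fin m × Fin m → Bool) → Bool :=
  fun x => decide (SimpleGraph.fromRel fun u v => x (u, v) = true).IsHamiltonian

/-- Crux 2 at an arbitrary budget function `g`. -/
def WindowHamAt (g : ℕ → ℕ) : Prop :=
  ∀ p : Polynomial ℕ, ∃ᶠ m in atTop,
    ¬ HasSymCircuit tcBasis (pointStabiliserBudget m (g m)) (p.eval m) (HamFn m)

/-- The route decl `WindowHam` is `WindowHamAt ⌊log₂ ·⌋`, definitionally (Disproof F1). -/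
theorem windowHam_iff : WindowHam ↔ WindowHamAt (Nat.log 2) := Iff.rfl

/-- The support item `PolylogHam` is `WindowHamAt ⌊log₂ ·⌋²`, definitionally (Disproof F1). -/
theorem polylogHam_iff : PolylogHam ↔ WindowHamAt (fun m => Nat.log 2 m ^ 2) := Iff.rfl

/-- Symmetry under a larger budget is symmetry under a smaller one (Disproof F3). -/
theorem hasSymCircuit_of_budget_le {m g g' s : ℕ} {B : Set GateFn}
    {f : (Fin m × Fin m → Bool) → Bool} (hg : g ≤ g')
    (h : HasSymCircuit B (pointStabiliserBudget m g') s f) :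
    HasSymCircuit B (pointStabiliserBudget m g) s f := by
  obtain ⟨C, hB, hs, hΓ, hf⟩ := h
  exact ⟨C, hB, hs, hΓ.mono (pointStabiliserBudget_mono m hg), hf⟩

/-- `WindowHamAt` is monotone in the budget (Disproof F3). -/
theorem windowHamAt_mono {g g' : ℕ → ℕ} (hg : ∀ m, g m ≤ g' m) (h : WindowHamAt g) :
    WindowHamAt g' := fun p =>
  (h p).mono fun m hm hm' => hm (hasSymCircuit_of_budget_le (hg m) hm')

/-- The plain threshold-circuit lower bound for HAM (budget 0; Disproof F3). -/
def HamHardGeneral : Prop :=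
  ∀ p : Polynomial ℕ, ∃ᶠ m in atTop,
    ¬ ∃ C : Circuit (Fin m × Fin m), C.IsOver tcBasis ∧ C.size ≤ p.eval m ∧ C.Computes (HamFn m)

/-- With budget `0` the symmetry condition is void (Disproof F3). -/
theorem hasSymCircuit_budget_zero_iff {m s : ℕ} {B : Set GateFn}
    {f : (Fin m × Fin m → Bool) → Bool} :
    HasSymCircuit B (pointStabiliserBudget m 0) s f ↔
      ∃ C : Circuit (Fin m × Fin m), C.IsOver B ∧ C.size ≤ s ∧ C.Computes f := by
  rw [pointStabiliserBudget_zero]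
  exact ⟨fun ⟨C, hB, hs, _, hf⟩ => ⟨C, hB, hs, hf⟩,
    fun ⟨C, hB, hs, hf⟩ => ⟨C, hB, hs, C.isSymmetricUnder_one, hf⟩⟩

/-- At budget `0` the crux shape is the plain lower bound (Disproof F3). -/
theorem windowHamAt_zero_iff : WindowHamAt (fun _ => 0) ↔ HamHardGeneral := by
  simp only [WindowHamAt, HamHardGeneral, hasSymCircuit_budget_zero_iff]

/-! ## §1 The compile crux at an arbitrary budget, and the deciding theorem at every budget -/

/-- Crux 3 (`HamCompiles`) at an arbitrary budget function `g`. -/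
def HamCompilesAt (g : ℕ → ℕ) : Prop :=
  PNPWave0.NP Bool ⊆ PNPWave0.P Bool →
    ∃ p : Polynomial ℕ, ∀ m : ℕ,
      HasSymCircuit tcBasis (pointStabiliserBudget m (g m)) (p.eval m) (HamFn m)

/-- The route decl `HamCompiles` is `HamCompilesAt ⌊log₂ ·⌋`, definitionally. -/
theorem hamCompiles_iff : HamCompiles ↔ HamCompilesAt (Nat.log 2) := Iff.rfl

/-- The route's deciding theorem holds verbatim at EVERY budget (pure logic). -/
theorem closes_at (g : ℕ → ℕ) (h₁ : WindowHamAt g) (h₂ : HamCompilesAt g) : _root_.PneNP := by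
  by_contra hne
  have hsub : PNPWave0.NP Bool ⊆ PNPWave0.P Bool :=
    fun L hL => by_contra fun hL' => hne ⟨L, hL, hL'⟩
  obtain ⟨p, hp⟩ := h₂ hsub
  obtain ⟨m, hm⟩ := (h₁ p).exists
  exact hm (hp m)

/-- Budget dichotomy (pure logic on filters): either `g = O(log m)` eventually, or `g / log₂ m`
is unbounded along a subsequence. -/
theorem budget_dichotomy (g : ℕ → ℕ) :
    (∃ T : ℕ, ∀ᶠ m in atTop, g m ≤ T * Nat.log 2 m) ∨
      (∀ T : ℕ, ∃ᶠ m in atTop, T * Nat.log 2 m < g m) := by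
  rw [or_iff_not_imp_left]
  intro h T
  push Not at h
  exact (h T).mono fun m hm => by simpa using hm

/-! ## LOW side: `g = O(log m)` — the powerset Held–Karp collapse (Disproof F10/F11) -/

/-- LOW-1 (F10, modulo formalisation debts (b)–(d) listed in Disproof F10/F11): under NP ⊆ P/poly,
Held–Karp over the `2^{g m} ≤ m^T` subsets of the free part, WL over the powerset expansion and a
P/poly decoder give poly-size window-symmetric HAM circuits at every large `m`; so the lower-bound
crux is refuted by `CircuitNeg` at EVERY budget `g = O(log m)`. -/
theorem not_windowHamAt_of_circuitNeg (g : ℕ → ℕ) (T : ℕ)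
    (hg : ∀ᶠ m in atTop, g m ≤ T * Nat.log 2 m) : CircuitNeg → ¬ WindowHamAt g := by
  sorry

/-- NP ⊆ P (Cook's classes over `{0,1}`) gives NP ⊆ P/poly (`CircuitNeg`), by the PROVED model bridges
`P_bool_eq_holds`, `np_bool_eq` and `P_subset_PPoly_holds` (the same three lines as route Circuit's
`closes`). -/
theorem circuitNeg_of_np_subset_p (hsub : PNPWave0.NP Bool ⊆ PNPWave0.P Bool) : CircuitNeg := by
  intro L hL
  have hP : PNPWave0.P Bool = Classes.P := Literature.Computability.Complexity.P_bool_eq_holds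
  have hN : PNPWave0.NP Bool = Nondeterministic.NP := Literature.Computability.Complexity.np_bool_eq
  have hLP : L ∈ PNPWave0.P Bool := hsub (hN ▸ hL)
  exact Literature.Computability.Complexity.P_subset_PPoly_holds (hP ▸ hLP)

/-- LANDED THEOREM, restated: this is verbatim
`Summit.PneNP.PneNP.Theorems.WindowHam.Negative.hasSym_ham_eventually_iff_forall` (direction `→`) of
`Theorems/WindowHam/Negative/InvariantDNFHam.lean` (gate-landed 2026-08-16T02:01Z: patch the finitely many
small `m` with the symmetric DNF of `HAM_m`). It carries a `sorry` here ONLY because the farm snapshot serving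
`lean check` had not yet built that module when this sketch was filed (`remote:stale:unbuilt`); replace the
body by `(Summit.PneNP.PneNP.Theorems.WindowHam.Negative.hasSym_ham_eventually_iff_forall g).1 h` and add the
import once it is built. Not a debt of the see-saw. -/
theorem patch_small_m (g : ℕ → ℕ)
    (h : ∃ p : Polynomial ℕ, ∃ N : ℕ, ∀ m ≥ N,
      HasSymCircuit tcBasis (pointStabiliserBudget m (g m)) (p.eval m) (HamFn m)) :
    ∃ p : Polynomial ℕ, ∀ m : ℕ,
      HasSymCircuit tcBasis (pointStabiliserBudget m (g m)) (p.eval m) (HamFn m) := by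
  sorry

/-- LOW-2 is a COROLLARY of LOW-1 (no extra debt): under NP ⊆ P we get `CircuitNeg`, hence
`¬ WindowHamAt g`, i.e. ONE polynomial and symmetric circuits from some threshold on, and the
symmetric DNF patches the finitely many small `m` (F8/F9, `hasSym_ham_eventually_iff_forall`).
So the compile crux is PROVABLE outright at every budget `g = O(log m)` once the collapse lands. -/
theorem hamCompilesAt_of_low (g : ℕ → ℕ) (T : ℕ)
    (hg : ∀ᶠ m in atTop, g m ≤ T * Nat.log 2 m) : HamCompilesAt g := by
  intro hsub
  have hW : ¬ WindowHamAt g := not_windowHamAt_of_circuitNeg g T hg (circuitNeg_of_np_subset_p hsub)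
  unfold WindowHamAt at hW
  push Not at hW
  obtain ⟨p, hp⟩ := hW
  obtain ⟨N, hN⟩ := Filter.eventually_atTop.1 hp
  exact patch_small_m g ⟨p, N, hN⟩

/-- LOW sandwich: at `g = O(log m)` the lower-bound crux sits between the plain threshold-circuit
lower bound for HAM and NP ⊄ P/poly (both outer arrows cheap; F3 + LOW-1). -/
theorem low_sandwich (g : ℕ → ℕ) (T : ℕ) (hg : ∀ᶠ m in atTop, g m ≤ T * Nat.log 2 m) :
    (HamHardGeneral → WindowHamAt g) ∧ (WindowHamAt g → ¬ CircuitNeg) :=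
  ⟨fun h => windowHamAt_mono (fun _ => Nat.zero_le _) (windowHamAt_zero_iff.2 h),
   fun h hneg => not_windowHamAt_of_circuitNeg g T hg hneg h⟩

/-! ## HIGH side: `g/log m` unbounded along a subsequence — supports + linear counting width -/

/-- HIGH-1 (support theorem in the linear-support regime, route sources DW ToC 2025 Thm 6.2 =
ToCL 2022 Thm 4.10, transferred to the point stabiliser; Anderson–Dawar Thm 6; linear counting
width of Hamiltonicity, arXiv:1901.07825 Lemma 14, planted on the free part as in `PolylogHam`):
along the subsequence where `T·log₂ m < g m` a size-`m^k` circuit has orbits `≤ 2^{(k/T)·g}`, hence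
supports of size `δ(k/T)·g` with `δ → 0` as `T → ∞`, below the counting width `α·g` of the planted
family; so `¬ HasSym` there, which is all `∃ᶠ` asks. -/
theorem windowHamAt_of_high (g : ℕ → ℕ)
    (hg : ∀ T : ℕ, ∃ᶠ m in atTop, T * Nat.log 2 m < g m) : WindowHamAt g := by
  sorry

/-- HIGH-2: once the lower-bound crux is a theorem, the compile crux is LITERALLY the summit. -/
theorem hamCompilesAt_iff_pneNP_of_high (g : ℕ → ℕ)
    (hg : ∀ T : ℕ, ∃ᶠ m in atTop, T * Nat.log 2 m < g m) : HamCompilesAt g ↔ _root_.PneNP := by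
  refine ⟨closes_at g (windowHamAt_of_high g hg), fun hP hsub => ?_⟩
  obtain ⟨L, hL, hL'⟩ := hP
  exact (hL' (hsub hL)).elim

/-! ## The see-saw -/

/-- SEE-SAW (modulo LOW-1 = the collapse F10, and HIGH-1 = supports + counting width; `patch_small_m`
is landed): at EVERY budget function `g`, either the lower-bound crux
is refuted by NP ⊆ P/poly while the compile crux is provable (so the route's content is exactly
`¬ CircuitNeg`, route Circuit's thesis), or the lower-bound crux is provable while the compile crux is
equivalent to `PneNP` itself. No budget makes both cruxes strictly easier than the summit. -/
theorem seesaw (g : ℕ → ℕ) :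
    ((CircuitNeg → ¬ WindowHamAt g) ∧ HamCompilesAt g) ∨
      (WindowHamAt g ∧ (HamCompilesAt g ↔ _root_.PneNP)) := by
  rcases budget_dichotomy g with ⟨T, hT⟩ | h
  · exact Or.inl ⟨not_windowHamAt_of_circuitNeg g T hT, hamCompilesAt_of_low g T hT⟩
  · exact Or.inr ⟨windowHamAt_of_high g h, hamCompilesAt_iff_pneNP_of_high g h⟩

/-- The filed route is the LOW case `g = ⌊log₂ m⌋` (T = 1). -/
theorem route_is_low : ∀ᶠ m in atTop, Nat.log 2 m ≤ 1 * Nat.log 2 m :=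
  Eventually.of_forall fun m => by simp

/-- Hence, for the filed cruxes: `HamCompiles` is provable (LOW-2) and `WindowHam → ¬ CircuitNeg`
(LOW-1) — with F3 (`windowHam_of_hamHardGeneral`) the crux is NP ⊄ P/poly in the window costume. -/
theorem filed_route_low : (CircuitNeg → ¬ WindowHam) ∧ HamCompiles :=
  ⟨fun hneg hW => not_windowHamAt_of_circuitNeg _ 1 route_is_low hneg (windowHam_iff.1 hW),
   hamCompiles_iff.2 (hamCompilesAt_of_low _ 1 route_is_low)⟩

/-- The support item's budget `⌊log₂ m⌋²` is the HIGH case (consistency with item 2148 `PolylogHam`,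
"theorem-level modulo formalisation"). -/
theorem polylog_is_high (T : ℕ) : ∃ᶠ m in atTop, T * Nat.log 2 m < Nat.log 2 m ^ 2 := by
  refine (Filter.eventually_atTop.2 ⟨2 ^ (T + 1), fun m hm => ?_⟩).frequently
  have h1 : T + 1 ≤ Nat.log 2 m := Nat.le_log_of_pow_le (by norm_num) hm
  have hL : 0 < Nat.log 2 m := by omega
  calc T * Nat.log 2 m < (T + 1) * Nat.log 2 m := (Nat.mul_lt_mul_right hL).2 (Nat.lt_succ_self T)
    _ ≤ Nat.log 2 m * Nat.log 2 m := Nat.mul_le_mul_right _ h1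
    _ = Nat.log 2 m ^ 2 := (sq _).symm

/-- So `PolylogHam` falls on the provable side of the see-saw (modulo HIGH-1), and re-keying the compile
crux to that budget would make it `PneNP` verbatim. -/
theorem polylog_side :
    PolylogHam ∧ (HamCompilesAt (fun m => Nat.log 2 m ^ 2) ↔ _root_.PneNP) :=
  ⟨polylogHam_iff.2 (windowHamAt_of_high _ polylog_is_high),
   hamCompilesAt_iff_pneNP_of_high _ polylog_is_high⟩

end Summit.PneNP.PneNP.Cruxes.WindowHam.SeeSaw
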